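import Summits.QuantumAdvantage.QuantumAdvantage.Theorems.HollowDialLaw
import Summits.QuantumAdvantage.QuantumAdvantage.Theorems.CodimDialFew
import Summits.QuantumAdvantage.QuantumAdvantage.Theorems.CylinderDialNecessity
import HarnessLib

/-!
# HollowDial — part 2/2: the ESCAPE DIAL (support for item stmt-QuantumAdvantage-28375 `FewCover3`)

Cell decomp-qadv, seat lens-5, generation 14.  Land port of §2 of the node «HollowDial»
(cell HOME/decomp-qadv-lens-5/g14/HollowDial.lean): the node's text VERBATIM except (i) namespace renamed from the Theses
to the Theorems tree, (ii) the route items are referred to through their Theorems-tree twins exactly as in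
`CodimDialFew` (`SpreadDial.PolyLoss3/AlgSpread3/SpreadLoss3/AlgCover3` and `Theorems.CodimDial.FewCover3/FewBridge3`,
definitionally the route's 26123/30970/29064/30909 and 28375/28376), (iii) `closes` goes through
`Theorems.CodimDial.closes₅` instead of the route file's `closes` + `codimDial_fewSplitGlue3` (so this part does not
import `Theses.CodimDial`).

Content: `FewSpread3` (the body of 28375), `EscNand3` — 28375 at its located core typed on the INPUT side (events =
NANDs of `r ≤ log₂ n` disjoint heavy block parities, `2∏|T_j| ≤ n`, `8 ∣ n`, so that ONE `δ₀`-ring of degree `≤ log₂ n`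
hosts the event: `escNand3_of_fewSpread3`, via `Theorems.TameDial.exists_nand_ring`), its necessity
`escNand3_of_spreadLoss3` / `escNand3_of_ringHardOdd`, the exact split `fewCover3_iff_esc : FewCover3 ↔ EscCover3 ∧ EscLift3`
with N(T) for both halves, the two PROVED ranges `escNandLight3_of_algSpread3` (light blocks `Σ|T_j| ≤ polylog`, from
30970) and `escNandThin3_of_polyLoss3` (thin cosets `|A_T| ≤ 2ⁿ/2n^k`, from 26123), and the node equation `closes`.
No `sorry`, no new axioms, no instances, no notation.
-/

set_option linter.style.longLine false
set_option linter.dupNamespace false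

noncomputable section

open scoped Classical

namespace Summit.QuantumAdvantage.QuantumAdvantage.Theorems.HollowDial

open Finset
open Literature.Computability.MetaComplexity
open Summit.QuantumAdvantage.QuantumAdvantage.Theses

variable {n : ℕ}

/-! ## §2 THE ESCAPE DIAL (route currency: the Theorems twins of the items of route CodimDial, leaf `AdviceFreeQNC0Three`) -/

section Dial

open Literature.Computability.QuantumComplexity
open Summit.QuantumAdvantage.AdviceFreeQNC0

/-- the FEW-RING SPREAD body (the conclusion of item 28375 `Theorems.CodimDial.FewCover3`, verbatim). -/
def FewSpread3 : Prop :=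
  ∃ η : ℝ, 0 < η ∧ ∃ k : ℕ, ∀ a c : ℕ, ∃ n₀ : ℕ, ∀ n ≥ n₀, ∀ P : Fin n → Literature.Computability.MetaComplexity.Smolensky.CubeFn (ZMod 3) n, (∀ i, P i ∈ Literature.Computability.MetaComplexity.Smolensky.lowDeg (ZMod 3) n ((Nat.log 2 n) ^ c)) → ∀ m : ℕ, m ≤ (Nat.log 2 n) ^ a → ∀ w : Fin m → Fin n → Bool, ∀ Q : Fin m → Fin n → Literature.Computability.MetaComplexity.Smolensky.CubeFn (ZMod 3) n, (∀ t i, Q t i ∈ Literature.Computability.MetaComplexity.Smolensky.lowDeg (ZMod 3) n ((Nat.log 2 n) ^ c)) → (1 - η) * (2 : ℝ) ^ n ≤ ((Finset.univ.filter fun y : Fin n → Bool => ∀ t, Literature.Computability.QuantumComplexity.RingHLF.Rel (w t) (fun i => decide (Q t i y = 1))).card : ℝ) → 1 / (n : ℝ) ^ k * (2 : ℝ) ^ n ≤ ((Finset.univ.filter fun y : Fin n → Bool => (∀ t, Literature.Computability.QuantumComplexity.RingHLF.Rel (w t) (fun i => decide (Q t i y = 1))) ∧ ¬ Literature.Computability.QuantumComplexity.RingHLF.Rel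 y (fun i => decide (P i y = 1))).card : ℝ)

/-- item 28375 unfolds to `PolyLoss3 → AlgSpread3 → FewSpread3` (definitional). -/
theorem fewCover3_iff_imp : Theorems.CodimDial.FewCover3 ↔ (SpreadDial.PolyLoss3 → SpreadDial.AlgSpread3 → FewSpread3) := Iff.rfl

/-- ★ `EscNand3` — ESCAPE FROM THE ALL-ODD COSET (the route's named first undecided instance of A = 28375, typed on the
INPUT side): some `η > 0` and `k` such that for every degree exponent `c`, all large ring lengths `n = 8t`, every
single-ring `𝔽₃` strategy `P` of degree `≤ (log₂ n)^c`, every block system `T₁ … T_r` (`r ≤ log₂ n`, `2·∏|T_j| ≤ n` —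
exactly the systems HOSTED by one foreign `δ₀`-ring, `Theorems.TameDial.exists_nand_ring`) whose parity-NAND event
`E = {y : ¬ ∀ j, ⊕_{T_j} y = 1}` has density `≥ 1 − η`: the victim loses on `≥ 2ⁿ/n^k` inputs INSIDE `E` — it cannot hide
its (≥ 2ⁿ/poly many, `PolyLoss3`) losses in the codimension-`r` all-odd coset. -/
def EscNand3 : Prop :=
  ∃ η : ℝ, 0 < η ∧ ∃ k : ℕ, ∀ c : ℕ, ∃ n₀ : ℕ, ∀ n ≥ n₀, 8 ∣ n →
    ∀ P : Fin n → Smolensky.CubeFn (ZMod 3) n, (∀ i, P i ∈ Smolensky.lowDeg (ZMod 3) n ((Nat.log 2 n) ^ c)) →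
    ∀ r ≤ Nat.log 2 n, ∀ T : Fin r → Finset (Fin n), 2 * (∏ j, (T j).card) ≤ n →
    (1 - η) * (2 : ℝ) ^ n ≤ ((univ.filter fun y : Fin n → Bool => ¬ ∀ j, bpar (T j) y = true).card : ℝ) →
    1 / (n : ℝ) ^ k * (2 : ℝ) ^ n ≤
      ((univ.filter fun y : Fin n → Bool => (¬ ∀ j, bpar (T j) y = true) ∧ ¬ RingHLF.Rel y (fun i => decide (P i y = 1))).card : ℝ)

/-- `EscCover3` — the COVER of the escape instance at poly-loss + algebraic-spread grade (the W-side refinement of A). -/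
def EscCover3 : Prop := SpreadDial.PolyLoss3 → SpreadDial.AlgSpread3 → EscNand3

/-- `EscLift3` — the complement: escape from the hosted parity cosets ⟹ pure cover for polylogarithmically many rings (A).
The declared residual OF THIS REFINEMENT (≡ A modulo `EscCover3`; no claim of shrinkage). -/
def EscLift3 : Prop := EscCover3 → Theorems.CodimDial.FewCover3

/-- `log₂ n ≥ 1` for `n ≥ 8`. -/
theorem log_pos_of_eight_le {n : ℕ} (hn : 8 ≤ n) : 1 ≤ Nat.log 2 n :=
  Nat.log_pos one_lt_two (by omega)

/-- the joint win event of the single hosted ring IS the parity-NAND event (set level). -/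
theorem filter_forall_fin_one_congr {n : ℕ} (p q : (Fin n → Bool) → Prop) [DecidablePred p] [DecidablePred q]
    (h : ∀ y, p y ↔ q y) :
    (univ.filter fun y : Fin n → Bool => ∀ _ : Fin 1, p y) = univ.filter fun y => q y := by
  refine filter_congr fun y _ => ?_
  rw [← h y]
  exact ⟨fun hh => hh 0, fun hh _ => hh⟩

/-- ★ HOSTING: few-ring spread (the body of A) ⟹ escape — put the parity-NAND ring on the single foreign seat (m = 1). -/
theorem escNand3_of_fewSpread3 (h : FewSpread3) : EscNand3 := by
  obtain ⟨η, hη, k, hk⟩ := h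
  refine ⟨η, hη, k, fun c => ?_⟩
  obtain ⟨n₀, hn₀⟩ := hk 0 (c + 1)
  refine ⟨max n₀ 8, fun n hn h8 P hP r hr T hT hdense => ?_⟩
  obtain ⟨t, rfl⟩ := h8
  have ht : 1 ≤ t := by omega
  have hM : (∏ j, (T j).card) ≤ 4 * t := by omega
  obtain ⟨Q, hQdeg, hQiff⟩ := Theorems.TameDial.exists_nand_ring ht T hM
  have hlog : 1 ≤ Nat.log 2 (8 * t) := log_pos_of_eight_le (by omega)
  have hpow : (Nat.log 2 (8 * t)) ^ c ≤ (Nat.log 2 (8 * t)) ^ (c + 1) := by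
    rw [pow_succ]
    exact Nat.le_mul_of_pos_right _ hlog
  have hr' : r ≤ (Nat.log 2 (8 * t)) ^ (c + 1) := hr.trans (Nat.le_self_pow (by omega) _)
  have hP' : ∀ i, P i ∈ Smolensky.lowDeg (ZMod 3) (8 * t) ((Nat.log 2 (8 * t)) ^ (c + 1)) :=
    fun i => Smolensky.lowDeg_mono hpow (hP i)
  have hQ' : ∀ (s : Fin 1) (i : Fin (8 * t)), (fun _ : Fin 1 => Q) s i ∈ Smolensky.lowDeg (ZMod 3) (8 * t) ((Nat.log 2 (8 * t)) ^ (c + 1)) :=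
    fun _ i => Smolensky.lowDeg_mono hr' (hQdeg i)
  have key := hn₀ (8 * t) (by omega) P hP' 1 (by simp) (fun _ => Theorems.delta0 t) (fun _ => Q) hQ'
  have hev : ∀ y : Fin (8 * t) → Bool,
      RingHLF.Rel (Theorems.delta0 t) (fun i => decide (Q i y = 1)) ↔ ¬ ∀ j, bpar (T j) y = true := by
    intro y
    rw [hQiff y]
    simp [bpar]
  have hE : (univ.filter fun y : Fin (8 * t) → Bool => ∀ _ : Fin 1, RingHLF.Rel (Theorems.delta0 t) (fun i => decide (Q i y = 1)))
      = univ.filter fun y => ¬ ∀ j, bpar (T j) y = true :=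
    filter_forall_fin_one_congr _ _ hev
  have hEL : (univ.filter fun y : Fin (8 * t) → Bool => (∀ _ : Fin 1, RingHLF.Rel (Theorems.delta0 t) (fun i => decide (Q i y = 1))) ∧
        ¬ RingHLF.Rel y (fun i => decide (P i y = 1)))
      = univ.filter fun y => (¬ ∀ j, bpar (T j) y = true) ∧ ¬ RingHLF.Rel y (fun i => decide (P i y = 1)) := by
    refine filter_congr fun y _ => ?_
    rw [← hev y]
    exact ⟨fun hh => ⟨hh.1 0, hh.2⟩, fun hh => ⟨fun _ => hh.1, hh.2⟩⟩
  rw [hE, hEL] at key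
  exact key hdense

/-- HOSTING at polynomial budget: foreign-spread loss (29064) ⟹ escape. -/
theorem escNand3_of_spreadLoss3 (h : SpreadDial.SpreadLoss3) : EscNand3 := by
  obtain ⟨η, hη, k, hk⟩ := h
  refine ⟨η, hη, k, fun c => ?_⟩
  obtain ⟨n₀, hn₀⟩ := hk (c + 1)
  refine ⟨max n₀ 8, fun n hn h8 P hP r hr T hT hdense => ?_⟩
  obtain ⟨t, rfl⟩ := h8
  have ht : 1 ≤ t := by omega
  have hM : (∏ j, (T j).card) ≤ 4 * t := by omega
  obtain ⟨Q, hQdeg, hQiff⟩ := Theorems.TameDial.exists_nand_ring ht T hM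
  have hlog : 1 ≤ Nat.log 2 (8 * t) := log_pos_of_eight_le (by omega)
  have hpow : (Nat.log 2 (8 * t)) ^ c ≤ (Nat.log 2 (8 * t)) ^ (c + 1) := by
    rw [pow_succ]
    exact Nat.le_mul_of_pos_right _ hlog
  have hr' : r ≤ (Nat.log 2 (8 * t)) ^ (c + 1) := hr.trans (Nat.le_self_pow (by omega) _)
  have hP' : ∀ i, P i ∈ Smolensky.lowDeg (ZMod 3) (8 * t) ((Nat.log 2 (8 * t)) ^ (c + 1)) :=
    fun i => Smolensky.lowDeg_mono hpow (hP i)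
  have hQ' : ∀ (s : Fin 1) (i : Fin (8 * t)), (fun _ : Fin 1 => Q) s i ∈ Smolensky.lowDeg (ZMod 3) (8 * t) ((Nat.log 2 (8 * t)) ^ (c + 1)) :=
    fun _ i => Smolensky.lowDeg_mono hr' (hQdeg i)
  have h1 : 1 ≤ (8 * t) ^ k := Nat.one_le_pow _ _ (by omega)
  have key := hn₀ (8 * t) (by omega) P hP' 1 h1 (fun _ => Theorems.delta0 t) (fun _ => Q) hQ'
  have hev : ∀ y : Fin (8 * t) → Bool,
      RingHLF.Rel (Theorems.delta0 t) (fun i => decide (Q i y = 1)) ↔ ¬ ∀ j, bpar (T j) y = true := by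
    intro y
    rw [hQiff y]
    simp [bpar]
  have hE : (univ.filter fun y : Fin (8 * t) → Bool => ∀ _ : Fin 1, RingHLF.Rel (Theorems.delta0 t) (fun i => decide (Q i y = 1)))
      = univ.filter fun y => ¬ ∀ j, bpar (T j) y = true :=
    filter_forall_fin_one_congr _ _ hev
  have hEL : (univ.filter fun y : Fin (8 * t) → Bool => (∀ _ : Fin 1, RingHLF.Rel (Theorems.delta0 t) (fun i => decide (Q i y = 1))) ∧
        ¬ RingHLF.Rel y (fun i => decide (P i y = 1)))
      = univ.filter fun y => (¬ ∀ j, bpar (T j) y = true) ∧ ¬ RingHLF.Rel y (fun i => decide (P i y = 1)) := by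
    refine filter_congr fun y _ => ?_
    rw [← hev y]
    exact ⟨fun hh => ⟨hh.1 0, hh.2⟩, fun hh => ⟨fun _ => hh.1, hh.2⟩⟩
  rw [hE, hEL] at key
  exact key hdense

/-- N(T): the rung's T = `RingHardOdd 3` implies escape (tree: T ⟹ 29064, `CylinderDial.spreadLoss3_of_ringHardOdd`). -/
theorem escNand3_of_ringHardOdd (h : RingHardOdd 3) : EscNand3 :=
  escNand3_of_spreadLoss3 (Theorems.CylinderDial.spreadLoss3_of_ringHardOdd h)

/-- WEAKER ⟸ A (PROVED): the escape cover is a sub-instance of item 28375. -/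
theorem escCover3_of_fewCover3 (h : Theorems.CodimDial.FewCover3) : EscCover3 :=
  fun hP hA => escNand3_of_fewSpread3 (h hP hA)

/-- trivially WEAKER ⟸ A. -/
theorem escLift3_of_fewCover3 (h : Theorems.CodimDial.FewCover3) : EscLift3 := fun _ => h

/-- ★ EXACT SPLIT of A = 28375 along the escape instance: `FewCover3 ⟺ EscCover3 ∧ EscLift3`. -/
theorem fewCover3_iff_esc : Theorems.CodimDial.FewCover3 ↔ EscCover3 ∧ EscLift3 :=
  ⟨fun h => ⟨escCover3_of_fewCover3 h, escLift3_of_fewCover3 h⟩, fun h => h.2 h.1⟩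

/-- N(T) for both halves. -/
theorem escCover3_of_ringHardOdd (h : RingHardOdd 3) : EscCover3 := fun _ _ => escNand3_of_ringHardOdd h
/-- N(T) for the lift half (T ⟹ A, tree `Theorems.CodimDial.fewCover3_of_ringHardOdd`). -/
theorem escLift3_of_ringHardOdd (h : RingHardOdd 3) : EscLift3 :=
  fun _ => (Theorems.CodimDial.fewCover3_of_ringHardOdd h : Theorems.CodimDial.FewCover3)

/-! ### The two PROVED ranges of the dial: LIGHT blocks (algebraic spread) and THIN cosets (poly loss) -/

/-- the `𝔽₃` indicator of "the `T`-parity of `y` is odd" (degree `|T|`): `2·(1 − Π_{i∈T}(1 − 2y_i))`. -/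
def oddInd (T : Finset (Fin n)) : Smolensky.CubeFn (ZMod 3) n := fun y => if bpar T y = true then 1 else 0

/-- the signed monomial of a block is `−1` on its odd class and `1` on its even class. -/
theorem pmMono_apply_bpar (T : Finset (Fin n)) (y : Fin n → Bool) :
    Smolensky.pmMono (ZMod 3) T y = if bpar T y = true then -1 else 1 := by
  unfold Smolensky.pmMono Smolensky.sgn bpar
  rw [Finset.prod_ite, Finset.prod_const, Finset.prod_const_one, mul_one, neg_one_pow_eq_pow_mod_two]
  rcases Nat.mod_two_eq_zero_or_one (T.filter fun i => y i = true).card with h | h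
  · rw [h]; simp
  · rw [h]; simp

/-- `oddInd T = 2·(1 − pmMono T)` over `𝔽₃`. -/
theorem oddInd_eq (T : Finset (Fin n)) : oddInd T = (2 : ZMod 3) • (1 - Smolensky.pmMono (ZMod 3) T) := by
  funext y
  rw [oddInd, Pi.smul_apply, Pi.sub_apply, Pi.one_apply, pmMono_apply_bpar, smul_eq_mul]
  split_ifs <;> decide

/-- `oddInd T` has degree `|T|`. -/
theorem oddInd_mem_lowDeg (T : Finset (Fin n)) : oddInd T ∈ Smolensky.lowDeg (ZMod 3) n T.card := by
  rw [oddInd_eq]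
  exact Submodule.smul_mem _ _ (Submodule.sub_mem _ (Smolensky.one_mem_lowDeg _) (Smolensky.pmMono_mem_lowDeg le_rfl))

/-- the `𝔽₃` indicator of the parity-NAND event, degree `Σ_j |T_j|`. -/
def nandInd {r : ℕ} (T : Fin r → Finset (Fin n)) : Smolensky.CubeFn (ZMod 3) n := 1 - ∏ j, oddInd (T j)

/-- `nandInd T` has degree `Σ_j |T_j|`. -/
theorem nandInd_mem_lowDeg {r : ℕ} (T : Fin r → Finset (Fin n)) :
    nandInd T ∈ Smolensky.lowDeg (ZMod 3) n (∑ j, (T j).card) :=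
  Submodule.sub_mem _ (Smolensky.one_mem_lowDeg _) (prod_mem_lowDeg_sum _ _ _ fun j _ => oddInd_mem_lowDeg (T j))

/-- `nandInd T` is the `𝔽₃` indicator of the parity-NAND event. -/
theorem nandInd_eq_one_iff {r : ℕ} (T : Fin r → Finset (Fin n)) (y : Fin n → Bool) :
    nandInd T y = 1 ↔ ¬ ∀ j, bpar (T j) y = true := by
  rw [nandInd, Pi.sub_apply, Pi.one_apply, Finset.prod_apply]
  simp only [oddInd]
  rw [Finset.prod_boole]
  split_ifs with h
  · simp only [sub_self, zero_ne_one, false_iff, not_not]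
    exact fun j => h j (mem_univ j)
  · simp only [sub_zero, true_iff]
    exact fun hall => h fun j _ => hall j

/-- `EscNandLight3` — escape for LIGHT block systems (`Σ_j |T_j| ≤ (log₂ n)^c`): PROVED from algebraic spread (30970),
because the parity-NAND event is then itself a dense `𝔽₃`-algebraic test of polylog degree. -/
def EscNandLight3 : Prop :=
  ∃ η : ℝ, 0 < η ∧ ∃ k : ℕ, ∀ c : ℕ, ∃ n₀ : ℕ, ∀ n ≥ n₀,
    ∀ P : Fin n → Smolensky.CubeFn (ZMod 3) n, (∀ i, P i ∈ Smolensky.lowDeg (ZMod 3) n ((Nat.log 2 n) ^ c)) →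
    ∀ r : ℕ, ∀ T : Fin r → Finset (Fin n), (∑ j, (T j).card) ≤ (Nat.log 2 n) ^ c →
    (1 - η) * (2 : ℝ) ^ n ≤ ((univ.filter fun y : Fin n → Bool => ¬ ∀ j, bpar (T j) y = true).card : ℝ) →
    1 / (n : ℝ) ^ k * (2 : ℝ) ^ n ≤
      ((univ.filter fun y : Fin n → Bool => (¬ ∀ j, bpar (T j) y = true) ∧ ¬ RingHLF.Rel y (fun i => decide (P i y = 1))).card : ℝ)

/-- ★ LIGHT RANGE PROVED. -/
theorem escNandLight3_of_algSpread3 (h : SpreadDial.AlgSpread3) : EscNandLight3 := by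
  obtain ⟨η, hη, k, hk⟩ := h
  refine ⟨η, hη, k, fun c => ?_⟩
  obtain ⟨n₀, hn₀⟩ := hk c
  refine ⟨n₀, fun n hn P hP r T hsum hdense => ?_⟩
  have hψ : nandInd T ∈ Smolensky.lowDeg (ZMod 3) n ((Nat.log 2 n) ^ c) :=
    Smolensky.lowDeg_mono hsum (nandInd_mem_lowDeg T)
  have key := hn₀ n hn P hP (nandInd T) hψ
  have hE : (univ.filter fun y : Fin n → Bool => nandInd T y = 1) = univ.filter fun y => ¬ ∀ j, bpar (T j) y = true :=
    filter_congr fun y _ => nandInd_eq_one_iff T y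
  have hEL : (univ.filter fun y : Fin n → Bool => nandInd T y = 1 ∧ ¬ RingHLF.Rel y (fun i => decide (P i y = 1)))
      = univ.filter fun y => (¬ ∀ j, bpar (T j) y = true) ∧ ¬ RingHLF.Rel y (fun i => decide (P i y = 1)) :=
    filter_congr fun y _ => by rw [nandInd_eq_one_iff]
  rw [hE, hEL] at key
  exact key hdense

/-- `EscNandThin3` — escape from NUMERICALLY THIN cosets (`|all-odd coset| ≤ 2ⁿ/(2n^k)`, e.g. `r ≥ (k+1)·log₂ n` disjoint
nonempty blocks): PROVED from poly loss (26123) by counting — the asymptotic end `r ≍ log n` of the codimension axis. -/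
def EscNandThin3 : Prop :=
  ∃ k : ℕ, ∀ c : ℕ, ∃ n₀ : ℕ, ∀ n ≥ n₀,
    ∀ P : Fin n → Smolensky.CubeFn (ZMod 3) n, (∀ i, P i ∈ Smolensky.lowDeg (ZMod 3) n ((Nat.log 2 n) ^ c)) →
    ∀ r : ℕ, ∀ T : Fin r → Finset (Fin n),
    2 * (n : ℝ) ^ k * ((univ.filter fun y : Fin n → Bool => ∀ j, bpar (T j) y = true).card : ℝ) ≤ (2 : ℝ) ^ n →
    1 / (n : ℝ) ^ (k + 1) * (2 : ℝ) ^ n ≤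
      ((univ.filter fun y : Fin n → Bool => (¬ ∀ j, bpar (T j) y = true) ∧ ¬ RingHLF.Rel y (fun i => decide (P i y = 1))).card : ℝ)

/-- ★ THIN RANGE PROVED. -/
theorem escNandThin3_of_polyLoss3 (h : SpreadDial.PolyLoss3) : EscNandThin3 := by
  obtain ⟨k, hk⟩ := h
  refine ⟨k, fun c => ?_⟩
  obtain ⟨n₀, hn₀⟩ := hk c
  refine ⟨max n₀ 2, fun n hn P hP r T hthin => ?_⟩
  have hW := hn₀ n (by omega) P hP
  -- the four finite sets
  set W := univ.filter fun y : Fin n → Bool => RingHLF.Rel y (fun i => decide (P i y = 1)) with hWdef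
  set L := univ.filter fun y : Fin n → Bool => ¬ RingHLF.Rel y (fun i => decide (P i y = 1)) with hLdef
  set A := univ.filter fun y : Fin n → Bool => ∀ j, bpar (T j) y = true with hAdef
  set EL := univ.filter fun y : Fin n → Bool => (¬ ∀ j, bpar (T j) y = true) ∧ ¬ RingHLF.Rel y (fun i => decide (P i y = 1)) with hELdef
  have hWL : W.card + L.card = 2 ^ n := by
    rw [hWdef, hLdef, Finset.card_filter_add_card_filter_not, Finset.card_univ, Fintype.card_fun, Fintype.card_bool, Fintype.card_fin]
  have hLle : L.card ≤ EL.card + A.card := by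
    have hsplit := Finset.card_filter_add_card_filter_not (s := L) (fun y : Fin n → Bool => ∀ j, bpar (T j) y = true)
    have h1 : (L.filter fun y : Fin n → Bool => ∀ j, bpar (T j) y = true).card ≤ A.card := by
      refine Finset.card_le_card ?_
      intro y hy
      rw [Finset.mem_filter] at hy
      rw [hAdef, Finset.mem_filter]
      exact ⟨mem_univ _, hy.2⟩
    have h2 : (L.filter fun y : Fin n → Bool => ¬ ∀ j, bpar (T j) y = true).card ≤ EL.card := by
      refine Finset.card_le_card ?_
      intro y hy
      rw [hLdef, Finset.mem_filter, Finset.mem_filter] at hy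
      rw [hELdef, Finset.mem_filter]
      exact ⟨mem_univ _, hy.2, hy.1.2⟩
    omega
  have hn2 : (2 : ℝ) ≤ n := by exact_mod_cast (show 2 ≤ n by omega)
  have hnk : (0 : ℝ) < (n : ℝ) ^ k := by positivity
  have hWLr : (W.card : ℝ) + L.card = (2 : ℝ) ^ n := by exact_mod_cast hWL
  have hLler : (L.card : ℝ) ≤ EL.card + A.card := by exact_mod_cast hLle
  -- poly loss, multiplied out: W * n^k ≤ (n^k - 1) * 2^n
  have hW' : (W.card : ℝ) * (n : ℝ) ^ k ≤ ((n : ℝ) ^ k - 1) * (2 : ℝ) ^ n := by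
    have := mul_le_mul_of_nonneg_right hW hnk.le
    have hrw : (1 - 1 / (n : ℝ) ^ k) * (2 : ℝ) ^ n * (n : ℝ) ^ k = ((n : ℝ) ^ k - 1) * (2 : ℝ) ^ n := by
      field_simp
    linarith [hrw]
  -- conclude: EL * n^(k+1) ≥ 2^n
  have hpos : (0 : ℝ) < (n : ℝ) ^ (k + 1) := by positivity
  rw [one_div, inv_mul_le_iff₀ hpos]
  have hEL : (2 : ℝ) ^ n ≤ 2 * (n : ℝ) ^ k * (EL.card : ℝ) := by nlinarith
  calc (2 : ℝ) ^ n ≤ 2 * (n : ℝ) ^ k * (EL.card : ℝ) := hEL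
    _ ≤ (n : ℝ) * (n : ℝ) ^ k * (EL.card : ℝ) := by
        have hE0 : (0 : ℝ) ≤ (EL.card : ℝ) := by positivity
        nlinarith
    _ = (n : ℝ) ^ (k + 1) * (EL.card : ℝ) := by ring

/-! ### The node equation -/

/-- ★ NODE EQUATION (gen 14, refining `CodimDial`:28375 `FewCover3 ⟺ EscCover3 ∧ EscLift3`): the leaf BY NAME through the
tree's `Theorems.CodimDial.closes₅` (the node itself goes through the route file's `closes` + `codimDial_fewSplitGlue3`).
Binders consumed 5/5. -/
theorem closes (hP : SpreadDial.PolyLoss3) (hAlg : SpreadDial.AlgCover3) (hE : EscCover3) (hL : EscLift3)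
    (hB : Theorems.CodimDial.FewBridge3) : AdviceFreeQNC0Three :=
  Theorems.CodimDial.closes₅ hP hAlg (hL hE) hB

/-- the node's frame statement. -/
def Assembly : Prop :=
  SpreadDial.PolyLoss3 → SpreadDial.AlgCover3 → EscCover3 → EscLift3 → Theorems.CodimDial.FewBridge3 → AdviceFreeQNC0Three

/-- the frame statement holds (= `closes`). -/
theorem assembly : Assembly := closes

end Dial
end Summit.QuantumAdvantage.QuantumAdvantage.Theorems.HollowDial
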